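import Mathlib
import Summits.Ventures.HodgeRepro.PeriodCloserC7Doubling

/-!
# PeriodCloserC7Spectral — the spectral decomposition (S1) and the term factorisation (S2) from the finite
expansion of the theta kernel and Howe-duality orthogonality

Blind re-derivation cell `pub-hodge-repro`, seat night-2 (gen 2).  Target tree path
`lean/Summits/Ventures/HodgeRepro/PeriodCloserC7Spectral.lean`.

Components (S1) `SpectralDecomposition` and (S2) `TermFactors` of `PeriodCloserC7Identification.lean` are, like
(D3) in `PeriodCloserC7Doubling.lean`, compositions of a finite-dimensional expansion and integration rules.  On
the compact quotient `[U(W)]` the theta kernel `Θ_{W^{(i)},V}(g, h; φ^{(i)})` of a datum is, as a function of `g` at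
the datum's level, a FINITE sum over the `τ` of the spectrum and over a basis `f` of the `τ`-isotypic level part,
`Θ(g, h) = Σ_τ Σ_f f(g) · θ(f̄, φ)(h)` (the definition of the theta lift `θ(f̄, φ)` of a vector, N. Harris IMRN 2014
Thm 5.15's objects); restricting `g` to the torus `[T_i]` and integrating against the character gives the plane
lift as `Σ_τ Σ_f 𝒫_{T_i}(χ; f) · θ(f̄, φ)`, with `𝒫_{T_i}(χ; f) = ∫_{[T_i]} χ(t) f(t) dt` the toric period of the basis
vector.  The ONE printed input is the orthogonality of the lifts of non-isomorphic `τ` (Howe duality, Kudla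
*Notes* p0022:L19–p0023:L1 (iii); Gan–Takeda 2016 Thm 1.2; quoted at `SpectralDecomposition`), which kills the
cross terms.  This file states the expansion, the orthogonality and the sum rules of the integrals as named
hypotheses (`SpectralExpansion`), DEFINES the `τ`-term as the double sum `Σ_{f,f'} 𝒫_T(χ;f) · \overline{𝒫_{T′}(χ′;f')}
· ⟨θ(f̄), θ(f̄')⟩` (`tauTerm`), and PROVES (S1) (`spectralDecomposition`) and (S2) (`termFactors`, from the
definitional links between the atoms of the face interface and the basis data).  Nothing here says anything
about the status of the Hodge conjecture for CM abelian varieties, which is NOT proved.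
-/

set_option autoImplicit false

noncomputable section

namespace Summit.Ventures.HodgeRepro.PeriodCloser

open NumberField

variable {L : Type} [Field L] [NumberField L] [IsCMField L]

/-- **The spectral kernel data**: an index type for the basis vectors of the level part of `L²([U(W)])`, the
finite basis of each `τ`, the spectrum of a datum, the basis vectors restricted to the tori `[T_0] ⊂ U(W)` and
`[T_1] ⊂ U(W′) ≅ U(W)`, and the theta lifts `θ(f̄, φ^{(i)})` of the basis vectors to `X` for the datum's Schwartz
data. -/
structure SpectralKernel (I : C7Face L) (D : DoublingInterface I) (K : KernelInterface I D) where
  /-- the index type of basis vectors -/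
  Idx : Type
  /-- the finite basis of the `τ`-isotypic level part -/
  basis : I.Tau → Finset Idx
  /-- the spectrum of the datum -/
  spectrum : I.Datum → Finset I.Tau
  /-- the basis vector `f`, restricted to `[T_i]` -/
  vec : Idx → (i : Fin 2) → K.TPt i → ℂ
  /-- the theta lift `θ(f̄, φ^{(i)})` of the basis vector `f` to `X`, for the datum's Schwartz data -/
  lift : I.Datum → Idx → (i : Fin 2) → K.XPt → ℂ

namespace SpectralKernel

variable {I : C7Face L} {D : DoublingInterface I} {K : KernelInterface I D} (B : SpectralKernel I D K)

/-- The toric period `𝒫_{T_i}(χ_{2i} ⊗ χ_{2i+1}; f) = ∫_{[T_i]} χ(t) f(t) dt` of the basis vector `f`. -/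
def toric (d : I.Datum) (i : Fin 2) (f : B.Idx) : ℂ := K.intT i (fun t => K.char d i t * B.vec f i t)

/-- The `L²(X)`-pairing `⟨θ(f̄, φ), θ(f̄', φ′)⟩` of two lifted basis vectors. -/
def pairLifts (d : I.Datum) (f f' : B.Idx) : ℂ :=
  K.intX (fun x => B.lift d f 0 x * starRingEnd ℂ (B.lift d f' 1 x))

/-- **The `τ`-term of the Hodge pairing**: `Σ_{f, f' ∈ basis τ} 𝒫_T(χ; f) · \overline{𝒫_{T′}(χ′; f')} · ⟨θ(f̄), θ(f̄')⟩`. -/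
def tauTerm (d : I.Datum) (τ : I.Tau) : ℂ :=
  ∑ f ∈ B.basis τ, ∑ f' ∈ B.basis τ, B.toric d 0 f * starRingEnd ℂ (B.toric d 1 f') * B.pairLifts d f f'

/-- The spectral interface defined by the kernel data. -/
def toSpectral : SpectralInterface I where
  spectrum := B.spectrum
  tauPairing := B.tauTerm

/-- **The hypotheses of the spectral decomposition.**  The finite expansion of the plane kernel along the
spectrum (`Θ(g, h) = Σ_τ Σ_f f(g) θ(f̄, φ)(h)`, restricted to `[T_i]`); the PRINTED orthogonality of the lifts of
non-isomorphic `τ` (Howe duality: Kudla *Notes* p0023:L1 «(iii) If θ_ψ(π_1) and θ_ψ(π_2) are nonzero and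
isomorphic, then π_1 ≃ π_2»; Gan–Takeda 2016 Thm 1.2 p0003:L82–83 for every residue characteristic; the
isotypic components of non-isomorphic irreducible representations are orthogonal in `L²([U(V)])` — the route's
reading with Rogawski's multiplicity one); and the sum rules of the integrals (finite additivity).  The two
definitional links tie the atoms of the face interface to the basis data: the toric period of `τ` against the
datum's characters is non-zero iff it is non-zero on some basis vector; a non-zero pairing of two lifted basis
vectors of `τ` witnesses `liftNonzero τ` (the lift of `τ` is non-zero with a `(2,0)`-component pairing
non-trivially). -/
structure SpectralExpansion (H : KernelComponents I D K) : Prop where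
  /-- the finite spectral expansion of the plane kernel on `[T_i] × X` -/
  expansion : ∀ (d : I.Datum) (i : Fin 2) (t : K.TPt i) (x : K.XPt),
    K.kernel d i t x = ∑ τ ∈ B.spectrum d, ∑ f ∈ B.basis τ, B.vec f i t * B.lift d f i x
  /-- PRINTED SHAPE — Howe duality: lifts of non-isomorphic `τ` are orthogonal -/
  orth : ∀ (d : I.Datum) (τ τ' : I.Tau), τ ≠ τ' → ∀ f ∈ B.basis τ, ∀ f' ∈ B.basis τ', B.pairLifts d f f' = 0
  /-- the torus integrals are finitely additive -/
  intT_sum : ∀ (i : Fin 2) (s : Finset B.Idx) (F : B.Idx → K.TPt i → ℂ),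
    K.intT i (fun t => ∑ a ∈ s, F a t) = ∑ a ∈ s, K.intT i (F a)
  /-- the torus integrals are finitely additive over the spectrum -/
  intT_sumTau : ∀ (i : Fin 2) (s : Finset I.Tau) (F : I.Tau → K.TPt i → ℂ),
    K.intT i (fun t => ∑ a ∈ s, F a t) = ∑ a ∈ s, K.intT i (F a)
  /-- the `X`-integral is finitely additive -/
  intX_sum : ∀ (s : Finset B.Idx) (F : B.Idx → K.XPt → ℂ),
    K.intX (fun x => ∑ a ∈ s, F a x) = ∑ a ∈ s, K.intX (F a)
  /-- the `X`-integral is finitely additive over the spectrum -/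
  intX_sumTau : ∀ (s : Finset I.Tau) (F : I.Tau → K.XPt → ℂ),
    K.intX (fun x => ∑ a ∈ s, F a x) = ∑ a ∈ s, K.intX (F a)
  /-- definitional link: the toric period of `τ` is non-zero iff it is non-zero on some basis vector (the level of
  the datum taken large enough that the level part of `τ` sees the toric functional) -/
  toric_link : ∀ (d : I.Datum) (i : Fin 2) (τ : I.Tau),
    I.toricPeriodNonzero i d τ ↔ ∃ f ∈ B.basis τ, B.toric d i f ≠ 0
  /-- definitional link: a non-zero pairing of lifted basis vectors of `τ` witnesses `liftNonzero τ` -/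
  lift_link : ∀ (d : I.Datum) (τ : I.Tau),
    (∃ f ∈ B.basis τ, ∃ f' ∈ B.basis τ, B.pairLifts d f f' ≠ 0) → I.liftNonzero τ

variable {B}

/-- The coefficient function of the plane lift is the spectral sum `Σ_τ Σ_f 𝒫_{T_i}(χ; f) · θ(f̄, φ^{(i)})`. -/
theorem coeff_planeLift {H : KernelComponents I D K} (E : B.SpectralExpansion H) (d : I.Datum) (i : Fin 2)
    (x : K.XPt) :
    K.coeff (D.planeLift d i) x = ∑ τ ∈ B.spectrum d, ∑ f ∈ B.basis τ, B.toric d i f * B.lift d f i x := by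
  rw [H.planeLift_def d i x]
  have h1 : (fun t => K.char d i t * K.kernel d i t x) =
      fun t => ∑ τ ∈ B.spectrum d, ∑ f ∈ B.basis τ, B.lift d f i x * (K.char d i t * B.vec f i t) := by
    funext t
    rw [E.expansion d i t x, Finset.mul_sum]
    refine Finset.sum_congr rfl fun τ _ => ?_
    rw [Finset.mul_sum]
    refine Finset.sum_congr rfl fun f _ => ?_
    ring
  rw [h1, E.intT_sumTau]
  refine Finset.sum_congr rfl fun τ _ => ?_
  rw [E.intT_sum]
  refine Finset.sum_congr rfl fun f _ => ?_
  rw [H.intT_smul, mul_comm]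
  rfl

/-- The Hodge pairing of the datum is the pairing of the two plane lifts ((D1), (D0), (D2)). -/
theorem hodgePairing_eq_planes (corner : CornerLifts I D) (forms : WitnessForms I D) (cup : CupProduct I D)
    (d : I.Datum) : I.hodgePairing d = D.hodge (D.planeLift d 0) (D.planeLift d 1) := by
  rw [forms d, corner d (line 0 0), corner d (line 0 1), corner d (line 1 0), corner d (line 1 1), cup d 0,
    cup d 1]

/-- The pairing of the two plane lifts is the full double spectral sum (before orthogonality). -/
theorem hodge_planes_eq_double_sum {H : KernelComponents I D K} (E : B.SpectralExpansion H) (d : I.Datum) :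
    D.hodge (D.planeLift d 0) (D.planeLift d 1) =
      ∑ τ ∈ B.spectrum d, ∑ τ' ∈ B.spectrum d, ∑ f ∈ B.basis τ, ∑ f' ∈ B.basis τ',
        B.toric d 0 f * starRingEnd ℂ (B.toric d 1 f') * B.pairLifts d f f' := by
  rw [H.hodge_def]
  have h1 : (fun x => K.coeff (D.planeLift d 0) x * starRingEnd ℂ (K.coeff (D.planeLift d 1) x)) =
      fun x => ∑ τ ∈ B.spectrum d, ∑ τ' ∈ B.spectrum d, ∑ f ∈ B.basis τ, ∑ f' ∈ B.basis τ',
        (B.toric d 0 f * starRingEnd ℂ (B.toric d 1 f')) *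
          (B.lift d f 0 x * starRingEnd ℂ (B.lift d f' 1 x)) := by
    funext x
    rw [coeff_planeLift E d 0 x, coeff_planeLift E d 1 x, map_sum, Finset.sum_mul_sum]
    refine Finset.sum_congr rfl fun τ _ => ?_
    refine Finset.sum_congr rfl fun τ' _ => ?_
    rw [map_sum, Finset.sum_mul_sum]
    refine Finset.sum_congr rfl fun f _ => ?_
    refine Finset.sum_congr rfl fun f' _ => ?_
    rw [map_mul]
    ring
  rw [h1, E.intX_sumTau]
  refine Finset.sum_congr rfl fun τ _ => ?_
  rw [E.intX_sumTau]
  refine Finset.sum_congr rfl fun τ' _ => ?_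
  rw [E.intX_sum]
  refine Finset.sum_congr rfl fun f _ => ?_
  rw [E.intX_sum]
  refine Finset.sum_congr rfl fun f' _ => ?_
  rw [H.intX_smul]
  rfl

/-- **(S1) from the spectral expansion**: the Hodge pairing is the sum of the `τ`-terms over the spectrum — the
cross terms `τ ≠ τ'` vanish by Howe-duality orthogonality. -/
theorem spectralDecomposition {H : KernelComponents I D K} (E : B.SpectralExpansion H) (corner : CornerLifts I D)
    (forms : WitnessForms I D) (cup : CupProduct I D) : SpectralDecomposition I B.toSpectral := by
  intro d
  show I.hodgePairing d = ∑ τ ∈ B.spectrum d, B.tauTerm d τ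
  rw [hodgePairing_eq_planes corner forms cup d, hodge_planes_eq_double_sum E d]
  refine Finset.sum_congr rfl fun τ hτ => ?_
  rw [Finset.sum_eq_single_of_mem τ hτ]
  · rfl
  · intro τ' _ hne
    refine Finset.sum_eq_zero fun f hf => ?_
    refine Finset.sum_eq_zero fun f' hf' => ?_
    rw [E.orth d τ τ' (Ne.symm hne) f hf f' hf', mul_zero]

/-- **(S2) from the spectral expansion**: a non-zero `τ`-term has a non-zero summand, whose three factors give
the toric periods of both tori on basis vectors of `τ` and a non-zero pairing of lifted basis vectors — the atoms
of (P′) through the definitional links. -/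
theorem termFactors {H : KernelComponents I D K} (E : B.SpectralExpansion H) : TermFactors I B.toSpectral := by
  intro d τ hne
  change B.tauTerm d τ ≠ 0 at hne
  obtain ⟨f, hf, hf0⟩ := Finset.exists_ne_zero_of_sum_ne_zero hne
  obtain ⟨f', hf', hff'⟩ := Finset.exists_ne_zero_of_sum_ne_zero hf0
  have h0 : B.toric d 0 f ≠ 0 := fun h => hff' (by rw [h, zero_mul, zero_mul])
  have h1 : B.toric d 1 f' ≠ 0 := fun h => hff' (by rw [h, map_zero, mul_zero, zero_mul])
  have h2 : B.pairLifts d f f' ≠ 0 := fun h => hff' (by rw [h, mul_zero])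
  refine ⟨fun i => ?_, E.lift_link d τ ⟨f, hf, f', hf', h2⟩⟩
  rw [E.toric_link]
  fin_cases i
  · exact ⟨f, hf, h0⟩
  · exact ⟨f', hf', h1⟩

/-- **(S1) ∧ (S2) ∧ (S3) from the spectral expansion and (S3)**: the seesaw components for the spectral interface
defined by the kernel data, with (S3) supplied. -/
theorem seesawComponents {H : KernelComponents I D K} (E : B.SpectralExpansion H) (corner : CornerLifts I D)
    (forms : WitnessForms I D) (cup : CupProduct I D) (isolate : IsolateTerm I B.toSpectral) :
    SeesawComponents I B.toSpectral :=
  ⟨spectralDecomposition E corner forms cup, termFactors E, isolate⟩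

end SpectralKernel

end Summit.Ventures.HodgeRepro.PeriodCloser

end
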